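/-
COR-CM (cell pub-hodgecm2, stage 2 of the Hodge ladder) — junction B01 `PerLFace_of_PerL`: the THETA-REALISATION SOCKET
(ROUTES-B01.md §3 R2 in tree form, as a socket theorem — not a displayed input).  Seat prover-pub-hodgecm2-own-b01-0 (single owner
of B01), 2026-08-21.  One structure (Type-valued data) and theorems; nothing cited as a record, nothing asserted.
-/
import Summits.HodgeConjecture.CorCM.B01.FaceInputsSplit
import Mathlib.Analysis.InnerProductSpace.Orthogonal
import HarnessLib

/-!
# B01: the theta-realisation socket — `PeriodThmF` (and `FaceSupply`) from face-scoped theta data over `L²`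

The stage-1 package proves its period statements through ONE engine `HodgeCM.StubTree.thm44_of_realisation` over a datum
`HodgeCM.Universe.ThetaRealisation ι₁ V K Ψ σ` (package `HodgeCM/Automorphic/Realisation.lean`): an `L²`-space `HG`, the wedge
map `Λ Γ ω ω' = emb Γ (ω ∪ ω')`, the theta one-forms `Theta i Γ ⊆ U_{Ψ_i}(Γ)`, Prop 4.3's line field, the isolation setting
(`gen12`, `S₁₂ = S₃₄`, `real34`), change of level, and «Petersson = period».  This file is the TREE SOCKET for a face-scoped
instance of that engine, with the isolation setting COLLAPSED to the single field the engine consumes: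

* `Universe.FaceThetaDatum U ι₁ V K Ψ σ` — data: an inner-product space `HG`; embeddings `emb Γ : H²(P_Γ, ℂ) → HG` of every
  level, compatible with the level coverings (`emb_cover`); theta one-form sets `Theta i Γ ⊆ U_{Ψ_i}(Γ)` (`Theta_sub`: [Y1neg]
  Thm 8.1(a) / Liu 2021 Thm 4.18); `lineField` (PerL Prop 4.3: a theta (12)-wedge with non-zero image); `coupling` (PerL Thm 3.7
  + Lemma 3.5 collapsed: every theta (12)-wedge-function lies in the CLOSED span of the theta (34)-wedge-functions over all levels);
  `inner_emb` (Borel–Wallach VII: `⟪emb y, emb x⟫ = c · tr(x ∪ conj y)` on `F²H²`, `c ≠ 0`).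
* `Universe.periodNV_of_faceThetaDatum` — THE ENGINE (port of `thm44_of_realisation`, steps 1–6; uses `Fact_pull_comp`,
  `Fact_pull_hodge`, `Fact_cup2_hodge`, `Fact_pull_cup` only): a `FaceThetaDatum` gives `U.PeriodNV ι₁ V K Ψ σ`.
* `Universe.periodThmF_of_faceThetaData`, `Universe.faceSupply_of_faceThetaData` — for face data at every face context:
  `PeriodThmF` and the displayed leaf B01-S.  `Model.perLFace_of_PerL_of_faceThetaData` — B01 BY NAME on the model universe
  (all four facts are tree theorems there).

WHY A SOCKET AND NOT A DISPLAYED INPUT: the datum is Type-valued (`HG`), so it is not a vacuity-checkable Prop like B01-S/H/O;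
it is the shape the stage-1 face head (ROUTES-B01 §7: sub-corner socket + Galois-scope guard) will PRODUCE, and it reaches
`PeriodThmF` WITHOUT the theta-exhaustion caveat of B01-C/B01-O (coupling is asked only of THETA wedges).  Nothing of the
manuscripts under adjudication is asserted.
-/

noncomputable section

open scoped TensorProduct InnerProductSpace

namespace Summit.HodgeConjecture.CorCM

open Literature.AlgebraicGeometry.Motives (CMType HodgeStructure)
open Literature.AlgebraicGeometry.Motives.HodgeStructure (EndAction conj)

/-- In an inner product space, a vector pairing non-trivially with an element of the closed span of a set pairs
non-trivially with some element of the set (port of the package lemma of the same name). [folklore] -/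
theorem exists_inner_ne_zero_of_mem_closure_span {E : Type*} [NormedAddCommGroup E] [InnerProductSpace ℂ E]
    {s : Set E} {v w : E} (hvw : ⟪v, w⟫_ℂ ≠ 0) (hs : w ∈ (Submodule.span ℂ s).topologicalClosure) :
    ∃ u ∈ s, ⟪v, u⟫_ℂ ≠ 0 := by
  by_contra h
  simp only [not_exists, not_and, not_not] at h
  have hle : (Submodule.span ℂ s).topologicalClosure ≤ (Submodule.span ℂ {v})ᗮ :=
    Submodule.topologicalClosure_minimal _
      (Submodule.span_le.mpr fun u hu => Submodule.mem_orthogonal_singleton_iff_inner_right.mpr (h u hu))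
      (Submodule.isClosed_orthogonal _)
  exact hvw (Submodule.mem_orthogonal_singleton_iff_inner_right.mp (hle hs))

namespace Universe

variable (U : Universe)

/-- **Face-scoped theta-realisation data** for a surface field `L` with `ι₁`, `(V₃,h)`, a one-form field `K` with four CM
types `Ψ i` and eigen-embedding `σ` (face setting: `K = L = F`, `Ψ = f.psi`, `σ = ι₁`) — the fields of the package's
`ThetaRealisation` that its engine consumes, with the isolation setting collapsed into `coupling`.  DATA (a `Type`), asserted
by no one. [folklore] -/
structure FaceThetaDatum {L : CMField} (ι₁ : L →+* ℂ) (V : HermSpace3 L ι₁) (K : CMField) (Ψ : Fin 4 → CMType K)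
    (σ : K →+* ℂ) : Type 1 where
  /-- `L²([G_U])` with the Petersson inner product -/
  HG : Type
  [instNACG : NormedAddCommGroup HG]
  [instIPS : InnerProductSpace ℂ HG]
  /-- PerL §3.1 / Matsushima: degree-two classes of `P_Γ` as `L²` functions on `[G_U]` -/
  emb : ∀ Γ : Level V, U.CohC (U.pms L ι₁ V Γ) 2 →ₗ[ℂ] HG
  /-- the theta one-forms of type `Ψ i` at level `Γ` -/
  Theta : Fin 4 → ∀ Γ : Level V, Set (U.CohC (U.pms L ι₁ V Γ) 1)
  /-- [Y1neg] Thm 8.1(a) / Liu 2021 Thm 4.18: theta one-forms of type `Ψ` are `A_Ψ`-isotypic `σ`-eigen holomorphic forms -/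
  Theta_sub : ∀ (i : Fin 4) (Γ : Level V), Theta i Γ ⊆ U.Uiso Γ K (Ψ i) σ
  /-- PerL Prop 4.3: at some level, a theta (12)-wedge with non-zero `L²`-image -/
  lineField : ∃ (Γ : Level V), ∃ ω₁ ∈ Theta 0 Γ, ∃ ω₂ ∈ Theta 1 Γ,
    emb Γ (U.cup2C (U.pms L ι₁ V Γ) 1 ω₁ ω₂) ≠ 0
  /-- PerL Thm 3.7 with Lemma 3.5 (collapsed): every theta (12)-wedge-function lies in the closed span of ALL theta
  (34)-wedge-functions (over all levels) -/
  coupling : ∀ (Γ : Level V) (ω₁ ω₂ : U.CohC (U.pms L ι₁ V Γ) 1), ω₁ ∈ Theta 0 Γ → ω₂ ∈ Theta 1 Γ →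
    emb Γ (U.cup2C (U.pms L ι₁ V Γ) 1 ω₁ ω₂) ∈ (Submodule.span ℂ
      {x : HG | ∃ (Γ' : Level V), ∃ ω₃ ∈ Theta 2 Γ', ∃ ω₄ ∈ Theta 3 Γ',
        x = emb Γ' (U.cup2C (U.pms L ι₁ V Γ') 1 ω₃ ω₄)}).topologicalClosure
  /-- the level covering `P_{Γ'} → P_Γ` for `Γ' ≤ Γ` (`K`-order of levels) -/
  cover : ∀ (Γ Γ' : Level V), Γ' ≤ Γ → U.Mor (U.pms L ι₁ V Γ') (U.pms L ι₁ V Γ)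
  /-- the `L²`-image of a class is unchanged by pull-back along a level covering -/
  emb_cover : ∀ (Γ Γ' : Level V) (h : Γ' ≤ Γ) (x : U.CohC (U.pms L ι₁ V Γ) 2),
    emb Γ' (U.pullC (cover Γ Γ' h) 2 x) = emb Γ x
  /-- Borel–Wallach VII: Petersson pairing = cup pairing on `(2,0)`-classes, up to a non-zero constant per level -/
  inner_emb : ∀ Γ : Level V, ∃ c : ℂ, c ≠ 0 ∧ ∀ x y : U.CohC (U.pms L ι₁ V Γ) 2,
    x ∈ (U.hodge (U.pms L ι₁ V Γ) 2).F 2 → y ∈ (U.hodge (U.pms L ι₁ V Γ) 2).F 2 →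
      ⟪emb Γ y, emb Γ x⟫_ℂ = c * U.trC (U.pms L ι₁ V Γ) 4 (U.cup2C (U.pms L ι₁ V Γ) 2 x (conj y))

attribute [instance] FaceThetaDatum.instNACG FaceThetaDatum.instIPS

variable {U}

/-- **THE ENGINE** (port of the package's `thm44_of_realisation`, steps 1–6, over the collapsed datum): face-scoped theta data
give `U.PeriodNV ι₁ V K Ψ σ`.  Line field ⇒ a non-zero theta (12)-wedge-function `v`; `coupling` + `⟪v, v⟫ ≠ 0` ⇒ `v` pairs
non-trivially with one theta (34)-wedge-function (`exists_inner_ne_zero_of_mem_closure_span`); common level (`Level` meets;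
`emb_cover`, `Fact_pull_cup`); Petersson = period (`inner_emb` on `(2,0)`-wedges of `U_Ψ`-classes, `cup2C_mem_F_two_of_Uiso`,
`period_eq_pairing_wedges`); multilinear expansion (`periodNV_of_period_ne_zero`). [folklore] -/
theorem periodNV_of_faceThetaDatum (hc : U.Fact_pull_comp) (hH : U.Fact_pull_hodge) (hcup2 : U.Fact_cup2_hodge)
    (hpc : U.Fact_pull_cup) {L : CMField} {ι₁ : L →+* ℂ} {V : HermSpace3 L ι₁} {K : CMField} {Ψ : Fin 4 → CMType K}
    {σ : K →+* ℂ} (R : U.FaceThetaDatum ι₁ V K Ψ σ) : U.PeriodNV ι₁ V K Ψ σ := by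
  classical
  -- Step 1: a theta (12)-wedge with non-zero image, at some level Γ₁
  obtain ⟨Γ₁, ω₁, hω₁, ω₂, hω₂, hv⟩ := R.lineField
  set v := R.emb Γ₁ (U.cup2C (U.pms L ι₁ V Γ₁) 1 ω₁ ω₂) with hv_def
  -- Step 2: it pairs non-trivially with one theta (34)-wedge-function, at some level Γ₂
  have hvS := R.coupling Γ₁ ω₁ ω₂ hω₁ hω₂
  obtain ⟨u, ⟨Γ₂, ω₃, hω₃, ω₄, hω₄, rfl⟩, hu⟩ :=
    exists_inner_ne_zero_of_mem_closure_span (inner_self_ne_zero.mpr hv) hvS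
  -- Step 3: pass to a common level Γ ≤ Γ₁, Γ₂
  obtain ⟨Γ, hΓ₁, hΓ₂⟩ := Level.exists_le_le Γ₁ Γ₂
  let a := U.pullC (R.cover Γ₁ Γ hΓ₁) 1 ω₁
  let b := U.pullC (R.cover Γ₁ Γ hΓ₁) 1 ω₂
  let c₃ := U.pullC (R.cover Γ₂ Γ hΓ₂) 1 ω₃
  let c₄ := U.pullC (R.cover Γ₂ Γ hΓ₂) 1 ω₄
  have ha : a ∈ U.Uiso Γ K (Ψ 0) σ := pullC_mem_Uiso hc _ K (Ψ 0) σ (R.Theta_sub 0 Γ₁ hω₁)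
  have hb : b ∈ U.Uiso Γ K (Ψ 1) σ := pullC_mem_Uiso hc _ K (Ψ 1) σ (R.Theta_sub 1 Γ₁ hω₂)
  have hc₃ : c₃ ∈ U.Uiso Γ K (Ψ 2) σ := pullC_mem_Uiso hc _ K (Ψ 2) σ (R.Theta_sub 2 Γ₂ hω₃)
  have hc₄ : c₄ ∈ U.Uiso Γ K (Ψ 3) σ := pullC_mem_Uiso hc _ K (Ψ 3) σ (R.Theta_sub 3 Γ₂ hω₄)
  -- the wedge-functions at the common level
  have e12 : R.emb Γ (U.cup2C (U.pms L ι₁ V Γ) 1 a b) = R.emb Γ₁ (U.cup2C (U.pms L ι₁ V Γ₁) 1 ω₁ ω₂) := by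
    rw [show U.cup2C (U.pms L ι₁ V Γ) 1 a b = U.pullC (R.cover Γ₁ Γ hΓ₁) (1 + 1) (U.cup2C _ 1 ω₁ ω₂) from
      (pullC_cup2C hpc _ 1 ω₁ ω₂).symm]
    exact R.emb_cover Γ₁ Γ hΓ₁ _
  have e34 : R.emb Γ (U.cup2C (U.pms L ι₁ V Γ) 1 c₃ c₄) = R.emb Γ₂ (U.cup2C (U.pms L ι₁ V Γ₂) 1 ω₃ ω₄) := by
    rw [show U.cup2C (U.pms L ι₁ V Γ) 1 c₃ c₄ = U.pullC (R.cover Γ₂ Γ hΓ₂) (1 + 1) (U.cup2C _ 1 ω₃ ω₄) from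
      (pullC_cup2C hpc _ 1 ω₃ ω₄).symm]
    exact R.emb_cover Γ₂ Γ hΓ₂ _
  -- Step 4: Petersson = period at level Γ
  obtain ⟨c, hc0, hcΛ⟩ := R.inner_emb Γ
  have hx : U.cup2C (U.pms L ι₁ V Γ) 1 a b ∈ (U.hodge (U.pms L ι₁ V Γ) (1 + 1)).F (1 + 1) :=
    cup2C_mem_F_two_of_Uiso hH hcup2 Γ K (Ψ 0) (Ψ 1) σ ha hb
  have hy : U.cup2C (U.pms L ι₁ V Γ) 1 c₃ c₄ ∈ (U.hodge (U.pms L ι₁ V Γ) (1 + 1)).F (1 + 1) :=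
    cup2C_mem_F_two_of_Uiso hH hcup2 Γ K (Ψ 2) (Ψ 3) σ hc₃ hc₄
  have hinner : ⟪R.emb Γ (U.cup2C _ 1 c₃ c₄), R.emb Γ (U.cup2C _ 1 a b)⟫_ℂ ≠ 0 := by
    rw [e12, e34]
    intro h0
    apply hu
    rw [← inner_conj_symm, h0, map_zero]
  have hper : U.period (U.pms L ι₁ V Γ) ![a, b, c₃, c₄] ≠ 0 := by
    have h := hcΛ (U.cup2C _ 1 a b) (U.cup2C _ 1 c₃ c₄) hx hy
    rw [period_eq_pairing_wedges]
    simp only [Matrix.cons_val_zero, Matrix.cons_val_one, Matrix.cons_val]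
    intro h0
    apply hinner
    rw [h]
    exact mul_eq_zero_of_right c h0
  -- Step 5: multilinear expansion to pure pull-backs
  refine periodNV_of_period_ne_zero Γ _ (fun i => ?_) hper
  match i with
  | 0 => exact ha
  | 1 => exact hb
  | 2 => exact hc₃
  | 3 => exact hc₄

/-- **`PeriodThmF` from face-scoped theta data at every face context** (the package's `periodThmF_holds`, tree form). [folklore] -/
theorem periodThmF_of_faceThetaData (hc : U.Fact_pull_comp) (hH : U.Fact_pull_hodge) (hcup2 : U.Fact_cup2_hodge)
    (hpc : U.Fact_pull_cup)
    (hR : ∀ (F : CMField), IsGalois ℚ F → 6 ≤ Module.finrank ℚ F → ∀ (f : Face F) (ι₁ : F →+* ℂ), f.Admissible ι₁ →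
      ∀ V : HermSpace3 F ι₁, Nonempty (U.FaceThetaDatum ι₁ V F f.psi ι₁)) :
    U.PeriodThmF := by
  intro F hG h6 f ι₁ hι V
  obtain ⟨R⟩ := hR F hG h6 f ι₁ hι V
  exact periodNV_of_faceThetaDatum hc hH hcup2 hpc R

/-- **The displayed leaf B01-S from face-scoped theta data** (line field + `Theta ⊆ U_Ψ`: a non-zero wedge-function has
non-zero wedge, hence non-zero factors). [folklore] -/
theorem faceSupply_of_faceThetaData
    (hR : ∀ (F : CMField), IsGalois ℚ F → 6 ≤ Module.finrank ℚ F → ∀ (f : Face F) (ι₁ : F →+* ℂ), f.Admissible ι₁ →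
      ∀ V : HermSpace3 F ι₁, Nonempty (U.FaceThetaDatum ι₁ V F f.psi ι₁)) :
    U.FaceSupply := by
  intro F hG h6 f ι₁ hι V
  obtain ⟨R⟩ := hR F hG h6 f ι₁ hι V
  obtain ⟨Γ, ω₁, hω₁, ω₂, hω₂, hv⟩ := R.lineField
  refine ⟨Γ, ω₁, ω₂, R.Theta_sub 0 Γ hω₁, R.Theta_sub 1 Γ hω₂, ?_, ?_⟩
  · rintro rfl
    exact hv (by rw [map_zero, LinearMap.zero_apply, map_zero])
  · rintro rfl
    exact hv (by rw [map_zero, map_zero])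

end Universe

/-! ### The model universe -/

namespace Model

open Literature.NumberTheory.Automorphic
open Literature.NumberTheory.Automorphic.PicardCM
open Literature.AlgebraicGeometry.HodgeTheory

/-- **B01 BY NAME from face-scoped theta data on the model universe** (the four facts are the tree theorems
`universeOf_fact_pull_comp/_pull_hodge/_cup2_hodge/_pull_cup`); `U.PerL` idle. [folklore] -/
theorem perLFace_of_PerL_of_faceThetaData
    (hR : ∀ (hHD : exists_isReal_hodgeModel) (hI : hodgePQ_independent_of_hodgeModel)
      (h₁ : BallQuotientUniformised) (h₃ : CMAbelianVarietyRealised),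
      ∀ (F : CMField), IsGalois ℚ F → 6 ≤ Module.finrank ℚ F → ∀ (f : Face F) (ι₁ : F →+* ℂ), f.Admissible ι₁ →
        ∀ V : HermSpace3 F ι₁, Nonempty ((picardCMUniverse hHD hI h₁ h₃).FaceThetaDatum ι₁ V F f.psi ι₁)) :
    PerLFace_of_PerL :=
  fun hHD hI h₁ h₃ _ => Universe.periodThmF_of_faceThetaData
    (universeOf_fact_pull_comp hHD hI (ballQuotientUniformisedDatum_of h₁) h₃)
    (universeOf_fact_pull_hodge hHD hI (ballQuotientUniformisedDatum_of h₁) h₃)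
    (universeOf_fact_cup2_hodge hHD hI (ballQuotientUniformisedDatum_of h₁) h₃)
    (universeOf_fact_pull_cup hHD hI (ballQuotientUniformisedDatum_of h₁) h₃) (hR hHD hI h₁ h₃)

end Model

end Summit.HodgeConjecture.CorCM

end
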